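import Summits.RiemannHypothesis.RiemannHypothesis.Theorems.NymanBeurlingMinimiser
import HarnessLib

/-!
# RiemannHypothesis / Nyman–Beurling — the CERTIFICATE LOGIC of the DATA rung as a theorem (RH-FREE per N):
residual + form lower bound ⇒ certified `d_N²` and `c⋆_N`; the form bound transfers to every leading block

Column LI/NB of the RH ladder, rung L-P(P2) «structure of the NB minimiser», PROOF-OF-DATA for cell `pub/rh-li`.  The
certified lineage R of DATA.md §L (kit j249067; docstring of its jobs/nbR/main.py) and the banked LINEAGE-2 design
(HOME/eng3/LINEAGE2-N1e4-DESIGN.md §1) certify every row from exactly three elementary facts about the quadratic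
programme `d²(x) = 1 − 2 b·x + x·Gx`: given ANY approximate solution `x̃`, a rigorous residual `r = b − G x̃` and a rigorous
form bound `s‖v‖² ≤ v·Gv` (`s > 0`),
`‖x̃ − c⋆‖ ≤ ‖r‖/s` and `d²(x̃) − ‖r‖²/s ≤ d_N² ≤ d²(x̃)`; and ONE form bound at the tier `M = N_c` serves every `N ≤ M`
(leading principal blocks).  This file proves exactly that, for the tree's objects:

* `nbDistSq_certificate`: `0 ≤ nbDistSq N x̃ − d_N² ≤ ‖r‖²/s` and `‖x̃ − c⋆_N‖² ≤ ‖r‖²/s²`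
  (`d²(x̃) − d_N² = (x̃ − c⋆)·G(x̃ − c⋆) = −(x̃ − c⋆)·r`, Cauchy–Schwarz on `Fin N`);
* `Certificate.dotProduct_nbGramMatrix_snoc_zero`, `nbGram_formBound_mono`: `s‖v‖² ≤ v·G_M v` on `Fin M` implies the same on
  every `Fin N`, `N ≤ M` (pad with zeros) — the «valid for all N ≤ N_c» clause of the tier certificates;
* `nbDistSq_certificate_of_tier`: the two combined.

RH-FREE [rh-li-eng-3]: finite-dimensional linear algebra; it says what the certified rows certify, nothing about `d_N → 0`;
nothing here bears on the truth of RH.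
-/

noncomputable section

-- D-0017: `Summit.<S>.<S>.…` is the designed namespace of a single-problem summit.
set_option linter.dupNamespace false

open MeasureTheory Set Finset
open scoped Matrix

namespace Summit.RiemannHypothesis.RiemannHypothesis.Theorems.NbTheory

open Literature.NumberTheory.LFunctions Literature.NumberTheory.LFunctions.BaezDuarteOnlyIf
open GramPosDef Minimiser

namespace Certificate

/-- Padding with a trailing zero does not change the Gram form: `(c,0)·G_{N+1}(c,0) = c·G_N c`. -/
lemma dotProduct_nbGramMatrix_snoc_zero {N : ℕ} (c : Fin N → ℝ) :
    (Fin.snoc c 0 : Fin (N + 1) → ℝ) ⬝ᵥ (nbGramMatrix (N + 1) *ᵥ (Fin.snoc c 0 : Fin (N + 1) → ℝ)) =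
      c ⬝ᵥ (nbGramMatrix N *ᵥ c) := by
  simp [dotProduct, Matrix.mulVec, nbGramMatrix, Fin.sum_univ_castSucc, Fin.snoc_castSucc, Fin.snoc_last]

/-- … nor the Euclidean norm: `‖(c,0)‖² = ‖c‖²`. -/
lemma sum_sq_snoc_zero {N : ℕ} (c : Fin N → ℝ) :
    ∑ i : Fin (N + 1), (Fin.snoc c 0 : Fin (N + 1) → ℝ) i ^ 2 = ∑ i : Fin N, c i ^ 2 := by
  simp [Fin.sum_univ_castSucc, Fin.snoc_castSucc, Fin.snoc_last]

/-- One step down: a form bound on `Fin (N+1)` gives the same bound on `Fin N`. -/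
lemma formBound_of_succ {N : ℕ} {s : ℝ}
    (h : ∀ v : Fin (N + 1) → ℝ, s * ∑ i, v i ^ 2 ≤ v ⬝ᵥ (nbGramMatrix (N + 1) *ᵥ v)) (c : Fin N → ℝ) :
    s * ∑ i, c i ^ 2 ≤ c ⬝ᵥ (nbGramMatrix N *ᵥ c) := by
  have := h (Fin.snoc c 0)
  rwa [dotProduct_nbGramMatrix_snoc_zero, sum_sq_snoc_zero] at this

/-- `d` steps down. -/
lemma formBound_of_add (d : ℕ) : ∀ {N : ℕ} {s : ℝ},
    (∀ v : Fin (N + d) → ℝ, s * ∑ i, v i ^ 2 ≤ v ⬝ᵥ (nbGramMatrix (N + d) *ᵥ v)) →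
      ∀ c : Fin N → ℝ, s * ∑ i, c i ^ 2 ≤ c ⬝ᵥ (nbGramMatrix N *ᵥ c) := by
  induction d with
  | zero => intro N s h c; exact h c
  | succ d ih => intro N s h c; exact ih (formBound_of_succ h) c

end Certificate

open Certificate

/-- **The form bound transfers to every leading block (RH-FREE):** if `s‖v‖² ≤ v·G_M v` for all `v : Fin M → ℝ`, then
`s‖c‖² ≤ c·G_N c` for all `c : Fin N → ℝ`, `N ≤ M` — ONE lower bound on the Gram form at the tier `M = N_c` certifies
every `N ≤ N_c` (the «by interlacing» clause of lineage R's tier certificates). -/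
theorem nbGram_formBound_mono {N M : ℕ} (hNM : N ≤ M) {s : ℝ}
    (h : ∀ v : Fin M → ℝ, s * ∑ i, v i ^ 2 ≤ v ⬝ᵥ (nbGramMatrix M *ᵥ v)) (c : Fin N → ℝ) :
    s * ∑ i, c i ^ 2 ≤ c ⬝ᵥ (nbGramMatrix N *ᵥ c) := by
  obtain ⟨d, rfl⟩ := Nat.exists_eq_add_of_le hNM
  exact formBound_of_add d h c

/-- **THE CERTIFICATE (RH-FREE per N).**  For ANY coefficient vector `x̃` (an approximate solution from any solver), with
residual `r_k = b_k − Σ_j G_{kj} x̃_j` and any `s > 0` such that `s‖v‖² ≤ v·Gv` on `Fin N`: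
`0 ≤ d²(x̃) − d_N²`, `d²(x̃) − d_N² ≤ ‖r‖²/s`, and `‖x̃ − c⋆_N‖² ≤ ‖r‖²/s²` — so `d_N² ∈ [d²(x̃) − ‖r‖²/s, d²(x̃)]` and every
coefficient `c⋆_{N,k} ∈ x̃_k ± ‖r‖/s`.  (This is what every certified row of DATA.md §L asserts.) -/
theorem nbDistSq_certificate {N : ℕ} {s : ℝ} (hs : 0 < s)
    (hG : ∀ v : Fin N → ℝ, s * ∑ i, v i ^ 2 ≤ v ⬝ᵥ (nbGramMatrix N *ᵥ v)) (x : Fin N → ℝ) :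
    0 ≤ nbDistSq N x - nbDistSq N (nbMinimiser N) ∧
      nbDistSq N x - nbDistSq N (nbMinimiser N) ≤
        (∑ k : Fin N, (nbRhs k - ∑ j : Fin N, nbGram k j * x j) ^ 2) / s ∧
      ∑ k : Fin N, (x k - nbMinimiser N k) ^ 2 ≤
        (∑ k : Fin N, (nbRhs k - ∑ j : Fin N, nbGram k j * x j) ^ 2) / s ^ 2 := by
  set e : Fin N → ℝ := x - nbMinimiser N with he
  set r : Fin N → ℝ := fun k ↦ nbRhs k - ∑ j : Fin N, nbGram k j * x j with hr
  set E : ℝ := ∑ i, e i ^ 2 with hE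
  set R : ℝ := ∑ i, r i ^ 2 with hR
  set F : ℝ := e ⬝ᵥ (nbGramMatrix N *ᵥ e) with hF
  -- `G e = G x − b = −r`
  have hGe : nbGramMatrix N *ᵥ e = -r := by
    rw [he, Matrix.mulVec_sub, nbGramMatrix_mulVec_nbMinimiser]
    funext k
    simp only [Pi.sub_apply, Pi.neg_apply, hr, Matrix.mulVec, dotProduct, nbGramMatrix, Matrix.of_apply]
    ring
  have hgap : nbDistSq N x - nbDistSq N (nbMinimiser N) = F := nbDistSq_sub_nbDistSq_nbMinimiser x
  have hFr : F = -(e ⬝ᵥ r) := by rw [hF, hGe, dotProduct_neg]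
  have hsE : s * E ≤ F := hG e
  have hE0 : 0 ≤ E := Finset.sum_nonneg fun i _ ↦ sq_nonneg _
  have hR0 : 0 ≤ R := Finset.sum_nonneg fun i _ ↦ sq_nonneg _
  have hF0 : 0 ≤ F := le_trans (mul_nonneg hs.le hE0) hsE
  -- Cauchy–Schwarz: `F² = (e·r)² ≤ E R`
  have hCS : F ^ 2 ≤ E * R := by
    rw [hFr, neg_sq]
    exact Finset.sum_mul_sq_le_sq_mul_sq _ _ _
  -- `F ≤ R/s`
  have hF : F ≤ R / s := by
    rw [le_div_iff₀ hs]
    rcases hF0.lt_or_eq with hpos | hzero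
    · -- `s F² ≤ s E R ≤ F R`
      have h1 : s * F ^ 2 ≤ F * R := by
        calc s * F ^ 2 ≤ s * (E * R) := by gcongr
          _ = (s * E) * R := by ring
          _ ≤ F * R := by gcongr
      have h2 : F * (F * s) ≤ F * R := by nlinarith
      exact le_of_mul_le_mul_left h2 hpos
    · rw [← hzero, zero_mul]; exact hR0
  refine ⟨hgap ▸ hF0, hgap ▸ hF, ?_⟩
  -- `E ≤ F/s ≤ R/s²`
  have hEF : E ≤ F / s := by rw [le_div_iff₀ hs]; linarith
  have hx : ∑ k : Fin N, (x k - nbMinimiser N k) ^ 2 = E := by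
    rw [hE]; exact Finset.sum_congr rfl fun k _ ↦ by simp [he]
  rw [hx]
  calc E ≤ F / s := hEF
    _ ≤ R / s / s := by gcongr
    _ = R / s ^ 2 := by rw [div_div, sq]

/-- **The tier certificate (RH-FREE).**  A form bound `s‖v‖² ≤ v·G_M v` established ONCE at a tier `M` certifies the rows of
every `N ≤ M`: for any approximate `x̃ : Fin N → ℝ` with residual `r`, `d_N² ∈ [d²(x̃) − ‖r‖²/s, d²(x̃)]` and
`‖x̃ − c⋆_N‖² ≤ ‖r‖²/s²`. -/
theorem nbDistSq_certificate_of_tier {N M : ℕ} (hNM : N ≤ M) {s : ℝ} (hs : 0 < s)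
    (hG : ∀ v : Fin M → ℝ, s * ∑ i, v i ^ 2 ≤ v ⬝ᵥ (nbGramMatrix M *ᵥ v)) (x : Fin N → ℝ) :
    0 ≤ nbDistSq N x - nbDistSq N (nbMinimiser N) ∧
      nbDistSq N x - nbDistSq N (nbMinimiser N) ≤
        (∑ k : Fin N, (nbRhs k - ∑ j : Fin N, nbGram k j * x j) ^ 2) / s ∧
      ∑ k : Fin N, (x k - nbMinimiser N k) ^ 2 ≤
        (∑ k : Fin N, (nbRhs k - ∑ j : Fin N, nbGram k j * x j) ^ 2) / s ^ 2 :=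
  nbDistSq_certificate hs (nbGram_formBound_mono hNM hG) x

end Summit.RiemannHypothesis.RiemannHypothesis.Theorems.NbTheory

end
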